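import Literature.Computability.Cryptography.InaccessibleEntropyPrefixHash
import Literature.Computability.Cryptography.InaccessibleEntropyProduct
import Literature.Computability.Cryptography.InaccessibleEntropyHashing
import HarnessLib

/-!
# UOWHF from inaccessible entropy: the single-candidate security bound of HHRVW 2020, Theorem 5.1 (Steps 1–4), combinatorial assembly

Topic `Literature/Computability/Cryptography`; sixth file of the "one-way functions ⇒ universal one-way hash
functions" line (Rompel 1990 = Goldreich 2004, Thm. 6.4.29, via Haitner–Holenstein–Reingold–Vadhan–Wee,
*Inaccessible Entropy II*, Theory of Computing 16(8), 2020; plan in `InaccessibleEntropyPrefixHash.lean`). It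
composes the single-input-length counting lemmas of the previous files into the security bound for ONE
candidate family of Theorem 5.1 — the family obtained from the hashed-prefix function `F` of Theorem 4.5 by
`t`-fold product (Step 1), input hashing (Step 2), output hashing (Step 3) and a random shift (Step 4) — for
one value of the (non-uniform) entropy estimate `k`, which enters only through the sizes of the hash ranges:

* `baseF`, `baseL` — `F(x,κ,i) = (h_κ(f x)_{1..i}, κ, i)` and `L(x,κ,i) = acc × {(κ,i)}` on the actual domain
  `𝒟 = 𝒳 × 𝒦 × [M]`; `realEntropy_baseF`, `accEntropy_baseL`, and **Theorem 4.5 as an entropy gap**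
  `accEntropy_add_le_realEntropy` (`accEntropy L + ⌊log₂T⌋/(12M) ≤ realEntropy F`, from Claim 4.7);
  `card_escape_baseL_eq_escCount`, `card_mul_card_escape_baseL_le` (Claim 4.6 on triples: for every
  `F`-collision finder `B₀`, `|𝒳| · #{B₀ ∉ L} ≤ T · |𝒦| · invSum(firstFinder B₀)`).
* generic Step 2–4 objects and their counted reductions: `hashIn` / `truncFam` / `card_move_hashIn_le` /
  `card_fiber_hashIn` (Lemma 5.4), `hashOut` / `sibFinder` / `card_move_hashOut_le` (Lemma 5.5), `shiftFinder` /
  `card_tcr_shift_eq` (Lemma 5.6).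
* `CandData` (the data of a candidate: `f`, `hp`, `h₂`, `h₃`, the parsing `e` of the shift domain), its levels
  `F₁, F₂, F₃`, the keyed family `fam y x = F₃(e(y + x))`, and the induced finders `advB3 → advA5 → advB2 → advA4
  → advB1 → advB0 → advA0` with their collision-finder properties.
* **`CandData.card_tcr_le`** — for every two-stage adversary `(x₀, A)` (functions of its coins) and any size
  bound `B` and image superset `Img`:
  `#{designated collisions} ≤ T·|𝒦|·invSum(advA0)/(|𝒳||𝒟|) + #{w : |∏L(wᵢ)| > B}·|G₂||G₃||Ρ||Ω|`
  `+ |G₃||Ρ||Ω|·Bad₂ + |Ρ||Ω|·Bad₃`,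
  with the residual counts bounded in section `Residual`: `card_large_piFamily_le` (Eq. (5.1), given
  `B ≥ 2^{t·accEntropy + tη log₂|𝒟|}`), `card_bad_truncFam_mul_le` (Eq. (5.4): `Bad₂·|R₂| ≤ |𝒟|ᵗ·max B 1·|G₂|`),
  `card_exists_image_collide_mul_le` + `card_image_mul_le` (Eq. (5.6)–(5.7), `InaccessibleEntropyHashing.lean`)
  with the light-set bound `card_light_hashIn_mul_le` / `le_card_fiber_hashIn_of_not_light` (Lemma 5.4 (i) via
  Chebyshev) and `card_small_fiber_prodMap_le` (Lemma 5.3 (i), given `N ≤ 2^{t·realEntropy − tη log₂|𝒟|}`).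

Dividing by the number `|D||Ρ||Ω|` of coin tuples, the bound reads `Pr[success] ≤ T·t·p_inv + exp(−2tη²) +
max(B,1)/|R₂| + |Img|/|R₃|` where `p_inv` is the success probability of the explicit inverter of Claim 4.6 run
on `advA0` (normalisation `invSum/(|𝒳|²M|Ω₀|)`, `|Ω₀| = t|𝒟|ᵗ|G₂||G₃||Ρ||Ω|`). What is NOT here: the choice of
the parameters `t, η, B, |R₂|, |R₃|` as functions of the security parameter (with the grid over `k`), the
concatenation over the grid with input-length extension (`UOWHFCombiners.lean`), and the machines (uniform
inverter, efficiency of the family) — the machine-level files. All statements proved; no named facts.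

## References

* I. Haitner, T. Holenstein, O. Reingold, S. Vadhan, H. Wee, *Inaccessible Entropy II: IE Functions and
  Universal One-Way Hashing*, Theory of Computing 16(8) (2020), Thm. 4.5, Claims 4.6–4.7, Lemmas 5.3–5.6,
  proof of Thm. 5.1, Steps 1–4 (pp. 26–31).
* J. Rompel, *One-way functions are necessary and sufficient for secure signatures*, STOC 1990.
* O. Goldreich, *Foundations of Cryptography II*, CUP 2004, Thm. 6.4.29.
-/

namespace Literature.Computability.Cryptography

namespace HHRVW

open Finset Real LeftoverHash

/-! ### The base function of Theorem 4.5 as a function on triples, and its set family -/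

section Base

variable {𝒳 𝒴 𝒦 P : Type*}

/-- The function of Theorem 4.5 on its actual domain `𝒟 = 𝒳 × 𝒦 × [M]`:
`F(x, κ, i) = (h_κ(f x)_{1..i}, κ, i)`. [cite: HaitnerEtAl2020, Thm. 4.5] -/
def baseF (f : 𝒳 → 𝒴) (hp : 𝒦 → ℕ → 𝒴 → P) (M : ℕ) (z : 𝒳 × 𝒦 × Fin M) : P × 𝒦 × Fin M :=
  (hp z.2.1 z.2.2 (f z.1), z.2.1, z.2.2)

/-- Embedding a first component next to fixed `(κ, i)`. [folklore] -/
def tripleEmb {M : ℕ} (κ : 𝒦) (i : Fin M) : 𝒳 ↪ 𝒳 × 𝒦 × Fin M :=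
  ⟨fun x' => (x', κ, i), fun _ _ h => (Prod.ext_iff.1 h).1⟩

/-- The accessible set family of Theorem 4.5 on triples: `L(x, κ, i) = acc(x, κ, i) × {(κ, i)}`.
[cite: HaitnerEtAl2020, Thm. 4.5, Eq. (4.4)] -/
def baseL [Fintype 𝒳] [DecidableEq 𝒴] [DecidableEq P] (f : 𝒳 → 𝒴) (hp : 𝒦 → ℕ → 𝒴 → P) (T M : ℕ)
    (z : 𝒳 × 𝒦 × Fin M) : Finset (𝒳 × 𝒦 × Fin M) :=
  (acc f hp T z.1 z.2.1 z.2.2).map (tripleEmb z.2.1 z.2.2)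

section BaseL

variable [Fintype 𝒳] [DecidableEq 𝒴] [DecidableEq P] (f : 𝒳 → 𝒴) (hp : 𝒦 → ℕ → 𝒴 → P) (T M : ℕ)

/-- Membership in `baseL`. [cite: HaitnerEtAl2020, Eq. (4.4)] -/
theorem mem_baseL {z z' : 𝒳 × 𝒦 × Fin M} :
    z' ∈ baseL f hp T M z ↔ z'.1 ∈ acc f hp T z.1 z.2.1 z.2.2 ∧ z'.2 = z.2 := by
  rcases z with ⟨x, κ, i⟩
  rcases z' with ⟨x', κ', i'⟩
  simp only [baseL, Finset.mem_map, tripleEmb, Function.Embedding.coeFn_mk, Prod.mk.injEq]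
  constructor
  · rintro ⟨a, ha, rfl, rfl, rfl⟩; exact ⟨ha, rfl, rfl⟩
  · rintro ⟨ha, rfl, rfl⟩
    exact ⟨x', ha, rfl, rfl, rfl⟩

/-- `z ∈ L(z)`. [cite: HaitnerEtAl2020, Def. 3.9] -/
theorem self_mem_baseL (z : 𝒳 × 𝒦 × Fin M) : z ∈ baseL f hp T M z :=
  (mem_baseL f hp T M).2 ⟨self_mem_acc f hp T _ _ _, rfl⟩

/-- `|L(x, κ, i)| = |acc(x, κ, i)|`. [cite: HaitnerEtAl2020, Eq. (4.4)] -/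
theorem card_baseL (z : 𝒳 × 𝒦 × Fin M) : (baseL f hp T M z).card = (acc f hp T z.1 z.2.1 z.2.2).card := by
  rw [baseL, Finset.card_map]

/-- `0 < |L(z)|`. [cite: HaitnerEtAl2020, Def. 3.9] -/
theorem card_baseL_pos (z : 𝒳 × 𝒦 × Fin M) : 0 < (baseL f hp T M z).card :=
  Finset.card_pos.2 ⟨z, self_mem_baseL f hp T M z⟩

/-- `F` is constant on `L(z)` (accessible elements are siblings). [cite: HaitnerEtAl2020, Eq. (4.4)] -/
theorem baseF_eq_of_mem_baseL {z z' : 𝒳 × 𝒦 × Fin M} (h : z' ∈ baseL f hp T M z) : baseF f hp M z' = baseF f hp M z := by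
  rw [mem_baseL] at h
  rcases z with ⟨x, κ, i⟩
  rcases z' with ⟨x', κ', i'⟩
  obtain ⟨ha, h2⟩ := h
  simp only at h2
  obtain ⟨rfl, rfl⟩ := Prod.ext_iff.1 h2
  simp only [baseF, Prod.mk.injEq, and_true]
  exact ((mem_acc f hp).1 ha).1

end BaseL

section Fiber

variable [Fintype 𝒳] [Fintype 𝒦] [DecidableEq 𝒦] [DecidableEq P] (f : 𝒳 → 𝒴) (hp : 𝒦 → ℕ → 𝒴 → P) (M : ℕ)

/-- The fibre of `F` through `(x, κ, i)` is the sibling set next to `(κ, i)`. [cite: HaitnerEtAl2020, Thm. 4.5] -/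
theorem fiber_baseF (z : 𝒳 × 𝒦 × Fin M) :
    fiber univ (baseF f hp M) (baseF f hp M z) = (sib f hp z.1 z.2.1 z.2.2).map (tripleEmb z.2.1 z.2.2) := by
  rcases z with ⟨x, κ, i⟩
  ext ⟨x', κ', i'⟩
  simp only [mem_fiber, Finset.mem_univ, true_and, baseF, Prod.mk.injEq, Finset.mem_map, tripleEmb,
    Function.Embedding.coeFn_mk, mem_sib]
  constructor
  · rintro ⟨h1, rfl, rfl⟩; exact ⟨x', h1, rfl, rfl, rfl⟩
  · rintro ⟨a, ha, rfl, rfl, rfl⟩; exact ⟨ha, rfl, rfl⟩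

/-- `|F⁻¹(F(x, κ, i))| = |S(x, κ, i)|`. [cite: HaitnerEtAl2020, Thm. 4.5] -/
theorem card_fiber_baseF (z : 𝒳 × 𝒦 × Fin M) :
    (fiber univ (baseF f hp M) (baseF f hp M z)).card = (sib f hp z.1 z.2.1 z.2.2).card := by
  rw [fiber_baseF, Finset.card_map]

/-- **The real entropy of `F⁻¹`** is the average of `log₂ |S(x, κ, i)|`. [cite: HaitnerEtAl2020, Def. 3.1 with Thm. 4.5] -/
theorem realEntropy_baseF :
    realEntropy (baseF f hp M) =
      (∑ x, ∑ κ, ∑ i : Fin M, Real.logb 2 ((sib f hp x κ i).card : ℝ)) / Fintype.card (𝒳 × 𝒦 × Fin M) := by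
  unfold realEntropy
  congr 1
  rw [Fintype.sum_prod_type]
  refine Finset.sum_congr rfl fun x _ => ?_
  rw [Fintype.sum_prod_type]
  refine Finset.sum_congr rfl fun κ _ => Finset.sum_congr rfl fun i _ => ?_
  rw [card_fiber_baseF]

end Fiber

section Ent

variable [Fintype 𝒳] [DecidableEq 𝒴] [Fintype 𝒦] [DecidableEq P] (f : 𝒳 → 𝒴) (hp : 𝒦 → ℕ → 𝒴 → P) (T M : ℕ)

/-- **The average accessible entropy of `L`** is the average of `log₂ |acc(x, κ, i)|`. [cite: HaitnerEtAl2020, Def. 3.9 with Thm. 4.5] -/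
theorem accEntropy_baseL :
    accEntropy (baseL f hp T M) =
      (∑ x, ∑ κ, ∑ i : Fin M, Real.logb 2 ((acc f hp T x κ i).card : ℝ)) / Fintype.card (𝒳 × 𝒦 × Fin M) := by
  unfold accEntropy
  congr 1
  rw [Fintype.sum_prod_type]
  refine Finset.sum_congr rfl fun x _ => ?_
  rw [Fintype.sum_prod_type]
  refine Finset.sum_congr rfl fun κ _ => Finset.sum_congr rfl fun i _ => ?_
  rw [card_baseL]

variable [DecidableEq 𝒦]

/-- **Theorem 4.5 as an entropy gap** (Claim 4.7 normalised): under the hypotheses of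
`sum_logb_card_acc_add_le`, `accEntropy L + ⌊log₂ T⌋ / (12 M) ≤ realEntropy F`.
[cite: HaitnerEtAl2020, Thm. 4.5 with Claim 4.7] -/
theorem accEntropy_add_le_realEntropy [Nonempty 𝒳] [Nonempty 𝒦] {M : ℕ} (hM0 : 0 < M)
    (h2 : PrefixPairwise f hp M) (h3 : PrefixThreewise f hp M)
    (hMX : Fintype.card 𝒳 < 2 ^ M) {T : ℕ} (hT : 0 < T) (hCP : 8 * collPairs f * T ≤ Fintype.card 𝒳 ^ 2) :
    accEntropy (baseL f hp T M) + (Nat.log 2 T : ℝ) / (12 * M) ≤ realEntropy (baseF f hp M) := by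
  rw [realEntropy_baseF, accEntropy_baseL]
  have h := sum_logb_card_acc_add_le (f := f) (hp := hp) h2 h3 hMX hT hCP
  have hcard : (Fintype.card (𝒳 × 𝒦 × Fin M) : ℝ) = Fintype.card 𝒳 * Fintype.card 𝒦 * M := by
    rw [Fintype.card_prod, Fintype.card_prod, Fintype.card_fin]; push_cast; ring
  rw [hcard]
  have hX : (0 : ℝ) < Fintype.card 𝒳 := by exact_mod_cast Fintype.card_pos
  have hK : (0 : ℝ) < Fintype.card 𝒦 := by exact_mod_cast Fintype.card_pos
  have hMr : (0 : ℝ) < M := by exact_mod_cast hM0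
  have hD : (0 : ℝ) < Fintype.card 𝒳 * Fintype.card 𝒦 * M := by positivity
  have heq : (∑ x, ∑ κ, ∑ i : Fin M, Real.logb 2 ((acc f hp T x κ i).card : ℝ)) / (Fintype.card 𝒳 * Fintype.card 𝒦 * M) +
      (Nat.log 2 T : ℝ) / (12 * M) =
      ((∑ x, ∑ κ, ∑ i : Fin M, Real.logb 2 ((acc f hp T x κ i).card : ℝ)) +
        Fintype.card 𝒳 * Fintype.card 𝒦 * Nat.log 2 T / 12) / (Fintype.card 𝒳 * Fintype.card 𝒦 * M) := by
    field_simp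
  rw [heq]
  exact div_le_div_of_nonneg_right h hD.le

end Ent

end Base

/-! ### Step 0: collision finders for the base function and the escape count -/

section Step0

variable {𝒳 𝒴 𝒦 P : Type*} [Fintype 𝒳] [DecidableEq 𝒳] [DecidableEq 𝒴] [Fintype 𝒦] [DecidableEq 𝒦] [DecidableEq P]
variable (f : 𝒳 → 𝒴) (hp : 𝒦 → ℕ → 𝒴 → P) (T M : ℕ) {Ω₀ : Type*} [Fintype Ω₀]

/-- The first-component finder `A(x, κ, i; c) = B₀((x, κ, i); c).1` of a finder `B₀` on triples, with the
prefix length as a natural number (junk `x` beyond `M`). [cite: HaitnerEtAl2020, Claim 4.6 (the finder `A₁`)] -/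
def firstFinder (B₀ : 𝒳 × 𝒦 × Fin M → Ω₀ → 𝒳 × 𝒦 × Fin M) (x : 𝒳) (κ : 𝒦) (i : ℕ) (c : Ω₀) : 𝒳 :=
  if h : i < M then (B₀ (x, κ, ⟨i, h⟩) c).1 else x

omit [Fintype 𝒳] [DecidableEq 𝒳] [DecidableEq 𝒴] [Fintype 𝒦] [DecidableEq 𝒦] [DecidableEq P] [Fintype Ω₀] in
/-- A `baseF`-collision finder keeps `(κ, i)` and outputs an `i`-prefix sibling. [cite: HaitnerEtAl2020, Def. 3.3] -/
theorem firstFinder_sibling {B₀ : 𝒳 × 𝒦 × Fin M → Ω₀ → 𝒳 × 𝒦 × Fin M}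
    (hB₀ : ∀ z c, baseF f hp M (B₀ z c) = baseF f hp M z) (x : 𝒳) (κ : 𝒦) (i : ℕ) (hi : i < M) (c : Ω₀) :
    hp κ i (f (firstFinder M B₀ x κ i c)) = hp κ i (f x) := by
  simp only [firstFinder, dif_pos hi]
  have h := hB₀ (x, κ, ⟨i, hi⟩) c
  simp only [baseF, Prod.mk.injEq] at h
  obtain ⟨h1, h2, h3⟩ := h
  rw [h2, h3] at h1
  exact h1

/-- **Escaping `L` on triples is the escape count of Claim 4.6**: for a `baseF`-collision finder `B₀`,
`#{(z, c) : B₀(z; c) ∉ L(z)} = escCount f T M (firstFinder B₀)`. [cite: HaitnerEtAl2020, Claim 4.6 with Eq. (4.4)–(4.6)] -/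
theorem card_escape_baseL_eq_escCount {B₀ : 𝒳 × 𝒦 × Fin M → Ω₀ → 𝒳 × 𝒦 × Fin M}
    (hB₀ : ∀ z c, baseF f hp M (B₀ z c) = baseF f hp M z) :
    ((((univ : Finset ((𝒳 × 𝒦 × Fin M) × Ω₀)).filter fun q : (𝒳 × 𝒦 × Fin M) × Ω₀ =>
        B₀ q.1 q.2 ∉ baseL f hp T M q.1).card : ℕ) : ℝ) =
      escCount f T M (firstFinder M B₀) := by
  classical
  rw [escCount, Finset.card_filter]
  push_cast
  rw [Fintype.sum_prod_type, Fintype.sum_prod_type]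
  refine Finset.sum_congr rfl fun x _ => ?_
  rw [Fintype.sum_prod_type]
  refine Finset.sum_congr rfl fun κ _ => Finset.sum_congr rfl fun i _ => Finset.sum_congr rfl fun c _ => ?_
  -- the output keeps `(κ, i)` and is a sibling, so escaping `L` is the escape condition of `acc`
  have h := hB₀ (x, κ, i) c
  simp only [baseF, Prod.mk.injEq] at h
  obtain ⟨h1, h2, h3⟩ := h
  have hfirst : firstFinder M B₀ x κ i c = (B₀ (x, κ, i) c).1 := by
    simp only [firstFinder, dif_pos i.isLt, Fin.eta]
  have hsib : hp κ i (f (B₀ (x, κ, i) c).1) = hp κ i (f x) := by rw [h2, h3] at h1; exact h1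
  have h23 : (B₀ (x, κ, i) c).2 = (κ, i) := Prod.ext h2 h3
  have hiff : B₀ (x, κ, i) c ∉ baseL f hp T M (x, κ, i) ↔
      (f (B₀ (x, κ, i) c).1 ≠ f x ∧ ¬ IsLight f T i (f (B₀ (x, κ, i) c).1)) := by
    rw [mem_baseL, ← not_mem_acc_iff f hp hsib]
    simp only [h23, and_true]
  rw [hfirst]
  by_cases he : f (B₀ (x, κ, i) c).1 ≠ f x ∧ ¬ IsLight f T i (f (B₀ (x, κ, i) c).1)
  · rw [if_pos (hiff.2 he), if_pos he]
  · rw [if_neg (fun h => he (hiff.1 h)), if_neg he]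

/-- **Claim 4.6 on triples**: for a `baseF`-collision finder `B₀`,
`|𝒳| · #{(z,c) : B₀(z;c) ∉ L(z)} ≤ T · |𝒦| · invSum f hp M (firstFinder B₀)`.
[cite: HaitnerEtAl2020, Claim 4.6] -/
theorem card_mul_card_escape_baseL_le [Nonempty 𝒦] (h2 : PrefixPairwise f hp M) {T : ℕ} (hT : 0 < T)
    {B₀ : 𝒳 × 𝒦 × Fin M → Ω₀ → 𝒳 × 𝒦 × Fin M} (hB₀ : ∀ z c, baseF f hp M (B₀ z c) = baseF f hp M z) :
    (Fintype.card 𝒳 : ℝ) * ((univ : Finset ((𝒳 × 𝒦 × Fin M) × Ω₀)).filter fun q : (𝒳 × 𝒦 × Fin M) × Ω₀ =>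
        B₀ q.1 q.2 ∉ baseL f hp T M q.1).card ≤
      T * Fintype.card 𝒦 * invSum f hp M (firstFinder M B₀) := by
  rw [card_escape_baseL_eq_escCount f hp T M hB₀]
  exact card_mul_escCount_le h2 hT _ fun x κ i hi c => firstFinder_sibling f hp M hB₀ x κ i hi c

variable {t : ℕ} {Ω₁ : Type*}

omit [Fintype 𝒳] [DecidableEq 𝒳] [DecidableEq 𝒴] [Fintype 𝒦] [DecidableEq 𝒦] [DecidableEq P] [Fintype Ω₀] in
/-- The planted coordinate finder of a product collision finder is a collision finder for the base
function. [cite: HaitnerEtAl2020, Lemma 5.3 (ii) (proof)] -/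
theorem baseF_coordAdv {B₁ : (Fin t → 𝒳 × 𝒦 × Fin M) → Ω₁ → (Fin t → 𝒳 × 𝒦 × Fin M)}
    (hB₁ : ∀ w c, prodMap (baseF f hp M) t (B₁ w c) = prodMap (baseF f hp M) t w)
    (z : 𝒳 × 𝒦 × Fin M) (c : Fin t × (Fin t → 𝒳 × 𝒦 × Fin M) × Ω₁) :
    baseF f hp M (coordAdv B₁ z c) = baseF f hp M z := by
  obtain ⟨j, w, r⟩ := c
  have h := congrFun (hB₁ (Function.update w j z) r) j
  simp only [prodMap, Function.update_self] at h
  exact h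

end Step0

/-! ### Step 2: hashing the input (generic) -/

section Step2

variable {α β G R : Type*} [Fintype α] [DecidableEq α] [Fintype G] [DecidableEq G]

/-- `F'(a, g) = (F a, g, h_g a)`. [cite: HaitnerEtAl2020, Lemma 5.4] -/
def hashIn (F : α → β) (h : G → α → R) (p : α × G) : β × G × R := (F p.1, p.2, h p.2 p.1)

/-- The truncated set family: `L(a)` if `|L(a)| ≤ B`, else `{a}`. This realises "accessible max-entropy at
most `log₂ B`" from a bound that holds only for most `a`. [cite: HaitnerEtAl2020, Lemma 5.3 (ii) ("this implies that `A'` has accessible max-entropy at most …")] -/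
def truncFam (L : α → Finset α) (B : ℕ) (a : α) : Finset α := if (L a).card ≤ B then L a else {a}

omit [Fintype α] [DecidableEq α] [Fintype G] [DecidableEq G] in
/-- `a ∈ truncFam L B a` when `a ∈ L a`. [cite: HaitnerEtAl2020, Lemma 5.3 (ii)] -/
theorem self_mem_truncFam {L : α → Finset α} (hL : ∀ a, a ∈ L a) (B : ℕ) (a : α) : a ∈ truncFam L B a := by
  unfold truncFam; split_ifs <;> simp [hL a]

omit [Fintype α] [DecidableEq α] [Fintype G] [DecidableEq G] in
/-- `|truncFam L B a| ≤ max B 1`. [cite: HaitnerEtAl2020, Lemma 5.3 (ii)] -/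
theorem card_truncFam_le (L : α → Finset α) (B : ℕ) (a : α) : (truncFam L B a).card ≤ max B 1 := by
  unfold truncFam; split_ifs with h
  · exact h.trans (le_max_left _ _)
  · rw [Finset.card_singleton]; exact le_max_right _ _

omit [Fintype G] [DecidableEq G] in
/-- Escaping the truncated family: either escaping `L`, or `L(a)` was large.
[cite: HaitnerEtAl2020, Lemma 5.3 (ii)] -/
theorem card_escape_truncFam_le {C : Type*} [Fintype C] (L : α → Finset α) (B : ℕ) (out : α → C → α) :
    ((univ : Finset (α × C)).filter fun q => out q.1 q.2 ∉ truncFam L B q.1).card ≤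
      ((univ : Finset (α × C)).filter fun q => out q.1 q.2 ∉ L q.1).card +
        ((univ : Finset α).filter fun a => B < (L a).card).card * Fintype.card C := by
  classical
  have hbig : ((univ : Finset α).filter fun a => B < (L a).card).card * Fintype.card C =
      ((univ : Finset (α × C)).filter fun q => B < (L q.1).card).card := by
    rw [← Finset.card_univ (α := C), ← Finset.card_product]
    congr 1
    ext ⟨a, c⟩
    simp
  rw [hbig]
  refine le_trans (Finset.card_le_card fun q hq => ?_) (Finset.card_union_le _ _)
  rw [Finset.mem_filter] at hq
  rw [Finset.mem_union, Finset.mem_filter, Finset.mem_filter]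
  by_cases hB : (L q.1).card ≤ B
  · left; refine ⟨Finset.mem_univ _, ?_⟩
    have := hq.2; unfold truncFam at this; rwa [if_pos hB] at this
  · right; exact ⟨Finset.mem_univ _, not_le.1 hB⟩

variable {Ω : Type*} [Fintype Ω]

/-- **Step 2 (Lemma 5.4 (ii)) for the truncated family, counted.** For a `hashIn F h`-collision finder `A'`
(`hA'`) and any set family `L` with `a ∈ L(a)`: the moves of `A'` are bounded by the escapes from `L` of the
induced first-component finder (key and coins as coins), plus `|G||Ω|` per input whose `L`-set exceeds `B`,
plus `|Ω|` per designated-collision pair, the latter counted by `card_exists_collide_mul_le` with sets of size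
`≤ max B 1`. [cite: HaitnerEtAl2020, Lemma 5.4 (ii) with Lemma 5.3 (ii)] -/
theorem card_move_hashIn_le [DecidableEq R] (F : α → β) (h : G → α → R) (L : α → Finset α) (B : ℕ)
    (A' : α → G → Ω → α × G) (hA' : ∀ a g c, hashIn F h (A' a g c) = hashIn F h (a, g)) :
    ((univ : Finset (α × G × Ω)).filter fun q => A' q.1 q.2.1 q.2.2 ≠ (q.1, q.2.1)).card ≤
      ((univ : Finset (α × (G × Ω))).filter fun q => (A' q.1 q.2.1 q.2.2).1 ∉ L q.1).card +
        ((univ : Finset α).filter fun a => B < (L a).card).card * (Fintype.card G * Fintype.card Ω) +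
        Fintype.card Ω * ((univ : Finset (α × G)).filter
          fun p => ∃ a' ∈ truncFam L B p.1, a' ≠ p.1 ∧ h p.2 a' = h p.2 p.1).card := by
  classical
  have hA2 : ∀ a g c, (A' a g c).2 = g := fun a g c => by
    have := hA' a g c; simp only [hashIn, Prod.mk.injEq] at this; exact this.2.1
  have hAh : ∀ a g c, h g (A' a g c).1 = h g a := fun a g c => by
    have := hA' a g c; simp only [hashIn, Prod.mk.injEq] at this
    have h3 := this.2.2; rw [this.2.1] at h3; exact h3
  have h1 := card_move_le_card_escape_add (h := h) (truncFam L B) A' hA2 hAh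
  have h2 := card_escape_truncFam_le (C := G × Ω) L B (fun a c => (A' a c.1 c.2).1)
  rw [Fintype.card_prod] at h2
  -- identify the escape counts over `α × G × Ω` and `α × (G × Ω)` (same type)
  have h3 : ((univ : Finset (α × G × Ω)).filter fun q => (A' q.1 q.2.1 q.2.2).1 ∉ truncFam L B q.1).card =
      ((univ : Finset (α × (G × Ω))).filter fun q => (A' q.1 q.2.1 q.2.2).1 ∉ truncFam L B q.1).card := rfl
  omega

/-- The fibre of `hashIn F h` through `(a, g)`: the `F`-siblings of `a` with the same `h_g`-value, next to `g`;
its size is `1 + |sameHash F h a g|`. [cite: HaitnerEtAl2020, Lemma 5.4 (i)] -/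
theorem card_fiber_hashIn [DecidableEq β] [DecidableEq R] (F : α → β) (h : G → α → R) (a : α) (g : G) :
    (fiber univ (hashIn F h) (hashIn F h (a, g))).card = (sameHash F h a g).card + 1 := by
  classical
  have hset : fiber univ (hashIn F h) (hashIn F h (a, g)) =
      (insert a (sameHash F h a g)).map ⟨fun a' => (a', g), fun x y hxy => (Prod.ext_iff.1 hxy).1⟩ := by
    ext ⟨a', g'⟩
    simp only [mem_fiber, Finset.mem_univ, true_and, hashIn, Prod.mk.injEq, Finset.mem_map,
      Finset.mem_insert, Function.Embedding.coeFn_mk, sameHash, Finset.mem_filter, Finset.mem_erase]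
    constructor
    · rintro ⟨hF, hg, hh⟩
      subst hg
      refine ⟨a', ?_, rfl, rfl⟩
      by_cases haa : a' = a
      · exact Or.inl haa
      · exact Or.inr ⟨⟨haa, hF⟩, hh⟩
    · rintro ⟨b, hb, rfl, rfl⟩
      rcases hb with rfl | ⟨⟨-, hb⟩, hh⟩
      · exact ⟨rfl, rfl, rfl⟩
      · exact ⟨hb, rfl, hh⟩
  rw [hset, Finset.card_map, Finset.card_insert_of_notMem]
  simp [sameHash]

end Step2

/-! ### Step 3: hashing the output (generic) -/

section Step3

variable {α β G R : Type*} [DecidableEq β]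

/-- `F''(a, g) = (g, h_g(F a))`. [cite: HaitnerEtAl2020, Lemma 5.5] -/
def hashOut (F : α → β) (h : G → β → R) (p : α × G) : G × R := (p.2, h p.2 (F p.1))

/-- The induced `F`-collision finder of Lemma 5.5: keep the answer if it is an `F`-sibling, else stay.
[cite: HaitnerEtAl2020, Lemma 5.5 (the algorithm `A`)] -/
def sibFinder {Ω : Type*} (F : α → β) (A'' : α → G → Ω → α × G) (a : α) (c : G × Ω) : α :=
  if F (A'' a c.1 c.2).1 = F a then (A'' a c.1 c.2).1 else a

/-- `sibFinder` is an `F`-collision finder. [cite: HaitnerEtAl2020, Lemma 5.5] -/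
theorem apply_sibFinder {Ω : Type*} (F : α → β) (A'' : α → G → Ω → α × G) (a : α) (c : G × Ω) :
    F (sibFinder F A'' a c) = F a := by
  unfold sibFinder; split_ifs with h
  · exact h
  · rfl

/-- **Step 3 (Lemma 5.5), counted**: for a `hashOut F h`-collision finder `A''`, its moves are bounded by
the moves of `sibFinder F A''` (genuine `F`-collisions on a random input) plus `|Ω|` per pair `(a, g)` for
which some image `y' ∈ Img`, `y' ≠ F a`, collides with `F a` under `h_g`.
[cite: HaitnerEtAl2020, Lemma 5.5] -/
theorem card_move_hashOut_le [Fintype α] [DecidableEq α] [Fintype G] [DecidableEq G] [DecidableEq R]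
    {Ω : Type*} [Fintype Ω] (F : α → β) {Img : Finset β} (hImg : ∀ a, F a ∈ Img) (h : G → β → R)
    (A'' : α → G → Ω → α × G) (hA'' : ∀ a g c, hashOut F h (A'' a g c) = hashOut F h (a, g)) :
    ((univ : Finset (α × G × Ω)).filter fun q => A'' q.1 q.2.1 q.2.2 ≠ (q.1, q.2.1)).card ≤
      ((univ : Finset (α × (G × Ω))).filter fun q => sibFinder F A'' q.1 q.2 ≠ q.1).card +
        Fintype.card Ω * ((univ : Finset (α × G)).filter
          fun p : α × G => ∃ y' ∈ Img, y' ≠ F p.1 ∧ h p.2 y' = h p.2 (F p.1)).card := by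
  classical
  have hA2 : ∀ a g c, (A'' a g c).2 = g := fun a g c => by
    have := hA'' a g c; simp only [hashOut, Prod.mk.injEq] at this; exact this.1
  have hAh : ∀ a g c, h g (F (A'' a g c).1) = h g (F a) := fun a g c => by
    have := hA'' a g c; simp only [hashOut, Prod.mk.injEq] at this
    have h3 := this.2; rw [this.1] at h3; exact h3
  have h1 := card_move_le_card_collision_add F hImg A'' hA2 hAh
  have h2 : ((univ : Finset (α × G × Ω)).filter fun q => (A'' q.1 q.2.1 q.2.2).1 ≠ q.1 ∧ F (A'' q.1 q.2.1 q.2.2).1 = F q.1).card =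
      ((univ : Finset (α × (G × Ω))).filter fun q => sibFinder F A'' q.1 q.2 ≠ q.1).card := by
    show ((univ : Finset (α × (G × Ω))).filter fun q => (A'' q.1 q.2.1 q.2.2).1 ≠ q.1 ∧ F (A'' q.1 q.2.1 q.2.2).1 = F q.1).card = _
    refine congrArg Finset.card (Finset.filter_congr fun q _ => ?_)
    unfold sibFinder
    split_ifs with hF
    · exact ⟨fun hh => hh.1, fun hh => ⟨hh, hF⟩⟩
    · simp [hF]
  omega

end Step3

/-! ### Step 4: the random shift (generic) -/

section Step4

variable {D V O : Type*} [AddCommGroup D] [DecidableEq O] {Ρ Ω : Type*}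

/-- The collision finder on random inputs induced by a two-stage adversary against the shifted family
`x ↦ F₃(e(y + x))`, transported to the domain `V` of `F₃` and made a genuine `F₃`-collision finder (stay put
unless a sibling is found). [cite: HaitnerEtAl2020, Lemma 5.6] -/
def shiftFinder (F₃ : V → O) (e : D ≃ V) (x₀ : Ρ → D) (A : D → Ρ → Ω → D) (v : V) (c : Ρ × Ω) : V :=
  if F₃ (e ((e.symm v - x₀ c.1) + A (e.symm v - x₀ c.1) c.1 c.2)) = F₃ v then
    e ((e.symm v - x₀ c.1) + A (e.symm v - x₀ c.1) c.1 c.2) else v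

/-- `shiftFinder` is an `F₃`-collision finder. [cite: HaitnerEtAl2020, Lemma 5.6] -/
theorem apply_shiftFinder (F₃ : V → O) (e : D ≃ V) (x₀ : Ρ → D) (A : D → Ρ → Ω → D) (v : V) (c : Ρ × Ω) :
    F₃ (shiftFinder F₃ e x₀ A v c) = F₃ v := by
  unfold shiftFinder; split_ifs with h
  · exact h
  · rfl

/-- **Step 4 (Lemma 5.6), counted**: the designated-collision count of `(x₀, A)` against the shifted family
`G_y(x) = F₃(e(y + x))` equals the number of `(v, c)` on which `shiftFinder` moves.
[cite: HaitnerEtAl2020, Lemma 5.6] -/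
theorem card_tcr_shift_eq [Fintype D] [DecidableEq D] [Fintype V] [DecidableEq V] [Fintype Ρ] [Fintype Ω]
    (F₃ : V → O) (e : D ≃ V) (x₀ : Ρ → D) (A : D → Ρ → Ω → D) :
    ((univ : Finset (D × Ρ × Ω)).filter fun q =>
        A q.1 q.2.1 q.2.2 ≠ x₀ q.2.1 ∧ F₃ (e (q.1 + A q.1 q.2.1 q.2.2)) = F₃ (e (q.1 + x₀ q.2.1))).card =
      ((univ : Finset (V × (Ρ × Ω))).filter fun q => shiftFinder F₃ e x₀ A q.1 q.2 ≠ q.1).card := by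
  classical
  have h5 := card_shift_collision_eq (F₃ ∘ e) x₀ A
  simp only [Function.comp_apply] at h5
  rw [← h5]
  -- transport along `e` : `(x, c) ↦ (e x, c)`
  have hset : ((univ : Finset (V × (Ρ × Ω))).filter fun q => shiftFinder F₃ e x₀ A q.1 q.2 ≠ q.1) =
      (((univ : Finset (D × Ρ × Ω)).filter fun q =>
        (q.1 - x₀ q.2.1) + A (q.1 - x₀ q.2.1) q.2.1 q.2.2 ≠ q.1 ∧
          F₃ (e ((q.1 - x₀ q.2.1) + A (q.1 - x₀ q.2.1) q.2.1 q.2.2)) = F₃ (e q.1)).map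
        (Equiv.prodCongr e (Equiv.refl (Ρ × Ω))).toEmbedding) := by
    ext ⟨v, ρ, ω⟩
    simp only [Finset.mem_filter, Finset.mem_univ, true_and, Finset.mem_map_equiv, Equiv.prodCongr_symm,
      Equiv.refl_symm, Equiv.prodCongr_apply, Prod.map_apply, Equiv.refl_apply, shiftFinder,
      Equiv.apply_symm_apply]
    constructor
    · intro hmove
      split_ifs at hmove with hF
      · exact ⟨fun heq => hmove (by rw [heq, Equiv.apply_symm_apply]), hF⟩
      · exact absurd rfl hmove
    · rintro ⟨hne, hF⟩
      rw [if_pos hF]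
      intro heq
      exact hne (e.injective (heq.trans (Equiv.apply_symm_apply e v).symm))
  rw [hset, Finset.card_map]

end Step4

/-! ### The candidate construction (Steps 1–4 composed) and its induced finders -/

section Candidate

variable (𝒳 𝒴 𝒦 P G₂ R₂ G₃ R₃ D : Type*) (M t : ℕ)

/-- The data of one candidate family of Theorem 5.1 (for one value of the advice `k`, which is reflected
only in the sizes of `R₂`, `R₃`): the function `f`, the hashed-prefix map, the input hash `h₂` on `t`-tuples,
the output hash `h₃`, and the parsing `e` of the shift domain. [cite: HaitnerEtAl2020, proof of Thm. 5.1, Steps 1–4] -/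
structure CandData where
  /-- the (one-way) function -/
  f : 𝒳 → 𝒴
  /-- the hashed `i`-prefix map `hp κ i y` -/
  hp : 𝒦 → ℕ → 𝒴 → P
  /-- the input hash of Step 2 -/
  h₂ : G₂ → (Fin t → 𝒳 × 𝒦 × Fin M) → R₂
  /-- the output hash of Step 3 -/
  h₃ : G₃ → ((Fin t → P × 𝒦 × Fin M) × G₂ × R₂) → R₃
  /-- the parsing of the shift domain -/
  e : D ≃ ((Fin t → 𝒳 × 𝒦 × Fin M) × G₂) × G₃

variable {𝒳 𝒴 𝒦 P G₂ R₂ G₃ R₃ D M t}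

namespace CandData

variable (C : CandData 𝒳 𝒴 𝒦 P G₂ R₂ G₃ R₃ D M t)

/-- Step 1: `F₁ = Fᵗ`. [cite: HaitnerEtAl2020, proof of Thm. 5.1, Step 1] -/
def F₁ : (Fin t → 𝒳 × 𝒦 × Fin M) → (Fin t → P × 𝒦 × Fin M) := prodMap (baseF C.f C.hp M) t

/-- Step 2: `F₂(w, g) = (F₁ w, g, g(w))`. [cite: HaitnerEtAl2020, proof of Thm. 5.1, Step 2] -/
def F₂ : (Fin t → 𝒳 × 𝒦 × Fin M) × G₂ → (Fin t → P × 𝒦 × Fin M) × G₂ × R₂ := hashIn C.F₁ C.h₂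

/-- Step 3: `F₃(u, g₃) = (g₃, g₃(F₂ u))`. [cite: HaitnerEtAl2020, proof of Thm. 5.1, Step 3] -/
def F₃ : ((Fin t → 𝒳 × 𝒦 × Fin M) × G₂) × G₃ → G₃ × R₃ := hashOut C.F₂ C.h₃

variable [AddCommGroup D]

/-- Step 4: the keyed family `G_y(x) = F₃(e(y + x))`. [cite: HaitnerEtAl2020, proof of Thm. 5.1, Step 4] -/
def fam (y x : D) : G₃ × R₃ := C.F₃ (C.e (y + x))

variable {Ρ Ω : Type*} [DecidableEq G₃] [DecidableEq R₃] [DecidableEq P] [DecidableEq 𝒦] [DecidableEq G₂] [DecidableEq R₂]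
  (x₀ : Ρ → D) (A : D → Ρ → Ω → D)

/-- The induced `F₃`-collision finder (Lemma 5.6). [cite: HaitnerEtAl2020, Lemma 5.6] -/
def advB3 : ((Fin t → 𝒳 × 𝒦 × Fin M) × G₂) × G₃ → Ρ × Ω → ((Fin t → 𝒳 × 𝒦 × Fin M) × G₂) × G₃ :=
  shiftFinder C.F₃ C.e x₀ A

/-- The same, curried for Lemma 5.5. [cite: HaitnerEtAl2020, Lemma 5.5] -/
def advA5 (u : (Fin t → 𝒳 × 𝒦 × Fin M) × G₂) (g₃ : G₃) (c : Ρ × Ω) : ((Fin t → 𝒳 × 𝒦 × Fin M) × G₂) × G₃ :=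
  C.advB3 x₀ A (u, g₃) c

/-- The induced `F₂`-collision finder (Lemma 5.5). [cite: HaitnerEtAl2020, Lemma 5.5] -/
def advB2 : (Fin t → 𝒳 × 𝒦 × Fin M) × G₂ → G₃ × (Ρ × Ω) → (Fin t → 𝒳 × 𝒦 × Fin M) × G₂ :=
  sibFinder C.F₂ (C.advA5 x₀ A)

/-- The same, curried for Lemma 5.4. [cite: HaitnerEtAl2020, Lemma 5.4] -/
def advA4 (w : Fin t → 𝒳 × 𝒦 × Fin M) (g : G₂) (c : G₃ × (Ρ × Ω)) : (Fin t → 𝒳 × 𝒦 × Fin M) × G₂ :=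
  C.advB2 x₀ A (w, g) c

/-- The induced `F₁`-collision finder (Lemma 5.4 (ii): drop the key). [cite: HaitnerEtAl2020, Lemma 5.4 (ii)] -/
def advB1 (w : Fin t → 𝒳 × 𝒦 × Fin M) (c : G₂ × (G₃ × (Ρ × Ω))) : Fin t → 𝒳 × 𝒦 × Fin M :=
  (C.advA4 x₀ A w c.1 c.2).1

/-- The induced `F`-collision finder (Lemma 5.3 (ii): plant at a coordinate). [cite: HaitnerEtAl2020, Lemma 5.3 (ii)] -/
def advB0 : 𝒳 × 𝒦 × Fin M → Fin t × (Fin t → 𝒳 × 𝒦 × Fin M) × (G₂ × (G₃ × (Ρ × Ω))) → 𝒳 × 𝒦 × Fin M :=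
  coordAdv (C.advB1 x₀ A)

/-- The finder fed to the inverter of Claim 4.6. [cite: HaitnerEtAl2020, Claim 4.6] -/
def advA0 : 𝒳 → 𝒦 → ℕ → Fin t × (Fin t → 𝒳 × 𝒦 × Fin M) × (G₂ × (G₃ × (Ρ × Ω))) → 𝒳 :=
  firstFinder M (C.advB0 x₀ A)

omit [DecidableEq P] [DecidableEq 𝒦] [DecidableEq G₂] [DecidableEq R₂] in
/-- `advA5` is a `hashOut`-collision finder. [cite: HaitnerEtAl2020, Lemma 5.6] -/
theorem hashOut_advA5 (u : (Fin t → 𝒳 × 𝒦 × Fin M) × G₂) (g₃ : G₃) (c : Ρ × Ω) :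
    hashOut C.F₂ C.h₃ (C.advA5 x₀ A u g₃ c) = hashOut C.F₂ C.h₃ (u, g₃) :=
  apply_shiftFinder _ _ _ _ _ _

/-- `advA4` is a `hashIn`-collision finder. [cite: HaitnerEtAl2020, Lemma 5.5] -/
theorem hashIn_advA4 (w : Fin t → 𝒳 × 𝒦 × Fin M) (g : G₂) (c : G₃ × (Ρ × Ω)) :
    hashIn C.F₁ C.h₂ (C.advA4 x₀ A w g c) = hashIn C.F₁ C.h₂ (w, g) :=
  apply_sibFinder _ _ _ _

/-- `advB1` is an `F₁`-collision finder. [cite: HaitnerEtAl2020, Lemma 5.4 (ii)] -/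
theorem F₁_advB1 (w : Fin t → 𝒳 × 𝒦 × Fin M) (c : G₂ × (G₃ × (Ρ × Ω))) :
    prodMap (baseF C.f C.hp M) t (C.advB1 x₀ A w c) = prodMap (baseF C.f C.hp M) t w := by
  have h := C.hashIn_advA4 x₀ A w c.1 c.2
  simp only [hashIn, Prod.mk.injEq] at h
  exact h.1

/-- `advB0` is an `F`-collision finder. [cite: HaitnerEtAl2020, Lemma 5.3 (ii)] -/
theorem baseF_advB0 (z : 𝒳 × 𝒦 × Fin M) (c : Fin t × (Fin t → 𝒳 × 𝒦 × Fin M) × (G₂ × (G₃ × (Ρ × Ω)))) :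
    baseF C.f C.hp M (C.advB0 x₀ A z c) = baseF C.f C.hp M z :=
  baseF_coordAdv C.f C.hp M (C.F₁_advB1 x₀ A) z c

end CandData

end Candidate

/-! ### The single-candidate security bound (Steps 1–4 chained) -/

section Final

variable {𝒳 𝒴 𝒦 P G₂ R₂ G₃ R₃ D : Type*} {M t : ℕ}
variable [Fintype 𝒳] [DecidableEq 𝒳] [DecidableEq 𝒴] [Fintype 𝒦] [DecidableEq 𝒦] [DecidableEq P]
variable [Fintype G₂] [DecidableEq G₂] [DecidableEq R₂] [Fintype G₃] [DecidableEq G₃]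
  [DecidableEq R₃] [Fintype D] [DecidableEq D] [AddCommGroup D]
variable {Ρ Ω : Type*} [Fintype Ρ] [Fintype Ω]

namespace CandData

/-- **HHRVW 2020, Theorem 5.1, Steps 1–4 for ONE candidate, as a counting inequality** (one input length,
every adversary, explicit right-hand side). For a two-stage adversary `(x₀, A)` against the keyed family
`G_y(x) = F₃(e(y + x))` of a candidate `C`, the number of coin tuples `(y, ρ, ω)` on which it forms a designated
collision is at most

  `T · |𝒦| · invSum(advA0) / (|𝒳| · |𝒟|)`      (Claim 4.6: the inverter's un-normalised success)
  `+ #{w : |L'(w)| > B} · |G₂||G₃||Ρ||Ω|`        (accessible side of gap amplification, Eq. (5.1))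
  `+ |G₃||Ρ||Ω| · Bad₂`                           (designated collisions inside the truncated `L'`, Eq. (5.4))
  `+ |Ρ||Ω| · Bad₃`                                (output-hash collisions among images, Eq. (5.7))

for ANY size bound `B` and ANY set `Img ⊇ Im F₂`, where `𝒟 = 𝒳 × 𝒦 × [M]`, `L' = ∏ L` and the three residual
counts are bounded separately (`card_accEntropy_piFamily_ge_le_exp`, `card_exists_collide_mul_le` with
`card_truncFam_le`, `card_exists_image_collide_mul_le` with `card_image_mul_le`). The chain is Lemma 5.6
(`card_tcr_shift_eq`) → Lemma 5.5 (`card_move_hashOut_le`) → Lemma 5.4 (ii) (`card_move_hashIn_le`) →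
Lemma 5.3 (ii) (`card_mul_card_escape_piFamily_le`) → Claim 4.6 (`card_mul_card_escape_baseL_le`).
[cite: HaitnerEtAl2020, Thm. 5.1 (proof, Steps 1–4) with Lemmas 5.3–5.6 and Claim 4.6] -/
theorem card_tcr_le [Nonempty 𝒳] [Nonempty 𝒦] (hM : 0 < M) (C : CandData 𝒳 𝒴 𝒦 P G₂ R₂ G₃ R₃ D M t)
    (h2 : PrefixPairwise C.f C.hp M) {T : ℕ} (hT : 0 < T) (B : ℕ)
    {Img : Finset ((Fin t → P × 𝒦 × Fin M) × G₂ × R₂)} (hImg : ∀ u, C.F₂ u ∈ Img)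
    (x₀ : Ρ → D) (A : D → Ρ → Ω → D) :
    (((univ : Finset (D × Ρ × Ω)).filter fun q =>
        A q.1 q.2.1 q.2.2 ≠ x₀ q.2.1 ∧ C.fam q.1 (A q.1 q.2.1 q.2.2) = C.fam q.1 (x₀ q.2.1)).card : ℝ) ≤
      T * Fintype.card 𝒦 * invSum C.f C.hp M (C.advA0 x₀ A) /
          (Fintype.card 𝒳 * Fintype.card (𝒳 × 𝒦 × Fin M)) +
        ((univ : Finset (Fin t → 𝒳 × 𝒦 × Fin M)).filter
            fun w => B < (piFamily (baseL C.f C.hp T M) t w).card).card *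
          (Fintype.card G₂ * (Fintype.card G₃ * (Fintype.card Ρ * Fintype.card Ω))) +
        (Fintype.card G₃ * (Fintype.card Ρ * Fintype.card Ω)) *
          ((univ : Finset ((Fin t → 𝒳 × 𝒦 × Fin M) × G₂)).filter fun p =>
            ∃ w' ∈ truncFam (piFamily (baseL C.f C.hp T M) t) B p.1, w' ≠ p.1 ∧ C.h₂ p.2 w' = C.h₂ p.2 p.1).card +
        (Fintype.card Ρ * Fintype.card Ω) *
          ((univ : Finset (((Fin t → 𝒳 × 𝒦 × Fin M) × G₂) × G₃)).filter fun p =>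
            ∃ y' ∈ Img, y' ≠ C.F₂ p.1 ∧ C.h₃ p.2 y' = C.h₃ p.2 (C.F₂ p.1)).card := by
  classical
  -- abbreviations
  set L₁ := piFamily (baseL C.f C.hp T M) t with hL₁
  -- Step 4: the shift (Lemma 5.6)
  have h4 : ((univ : Finset (D × Ρ × Ω)).filter fun q =>
        A q.1 q.2.1 q.2.2 ≠ x₀ q.2.1 ∧ C.fam q.1 (A q.1 q.2.1 q.2.2) = C.fam q.1 (x₀ q.2.1)).card =
      ((univ : Finset ((((Fin t → 𝒳 × 𝒦 × Fin M) × G₂) × G₃) × (Ρ × Ω))).filter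
        fun q => C.advB3 x₀ A q.1 q.2 ≠ q.1).card :=
    card_tcr_shift_eq C.F₃ C.e x₀ A
  -- reassociate to the shape of Lemma 5.5
  have h4' : ((univ : Finset ((((Fin t → 𝒳 × 𝒦 × Fin M) × G₂) × G₃) × (Ρ × Ω))).filter
        fun q => C.advB3 x₀ A q.1 q.2 ≠ q.1).card =
      ((univ : Finset (((Fin t → 𝒳 × 𝒦 × Fin M) × G₂) × G₃ × (Ρ × Ω))).filter
        fun q => C.advA5 x₀ A q.1 q.2.1 q.2.2 ≠ (q.1, q.2.1)).card := by
    rw [show ((univ : Finset (((Fin t → 𝒳 × 𝒦 × Fin M) × G₂) × G₃ × (Ρ × Ω))).filter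
        fun q => C.advA5 x₀ A q.1 q.2.1 q.2.2 ≠ (q.1, q.2.1)) =
      (((univ : Finset ((((Fin t → 𝒳 × 𝒦 × Fin M) × G₂) × G₃) × (Ρ × Ω))).filter
        fun q => C.advB3 x₀ A q.1 q.2 ≠ q.1).map (Equiv.prodAssoc _ _ _).toEmbedding) from ?_, Finset.card_map]
    ext ⟨u, g₃, c⟩
    simp [Equiv.prodAssoc, CandData.advA5]
  -- Step 3 (Lemma 5.5)
  have h3 := card_move_hashOut_le C.F₂ hImg C.h₃ (C.advA5 x₀ A) (C.hashOut_advA5 x₀ A)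
  -- identify the `sibFinder` count with the moves of `advA4` (reassociate)
  have h3' : ((univ : Finset (((Fin t → 𝒳 × 𝒦 × Fin M) × G₂) × (G₃ × (Ρ × Ω)))).filter
        fun q => sibFinder C.F₂ (C.advA5 x₀ A) q.1 q.2 ≠ q.1).card =
      ((univ : Finset ((Fin t → 𝒳 × 𝒦 × Fin M) × G₂ × (G₃ × (Ρ × Ω)))).filter
        fun q => C.advA4 x₀ A q.1 q.2.1 q.2.2 ≠ (q.1, q.2.1)).card := by
    rw [show ((univ : Finset ((Fin t → 𝒳 × 𝒦 × Fin M) × G₂ × (G₃ × (Ρ × Ω)))).filter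
        fun q => C.advA4 x₀ A q.1 q.2.1 q.2.2 ≠ (q.1, q.2.1)) =
      (((univ : Finset (((Fin t → 𝒳 × 𝒦 × Fin M) × G₂) × (G₃ × (Ρ × Ω)))).filter
        fun q => sibFinder C.F₂ (C.advA5 x₀ A) q.1 q.2 ≠ q.1).map (Equiv.prodAssoc _ _ _).toEmbedding) from ?_,
      Finset.card_map]
    ext ⟨w, g, c⟩
    simp [Equiv.prodAssoc, CandData.advA4, CandData.advB2]
  -- Step 2 (Lemma 5.4 (ii))
  have h2' := card_move_hashIn_le C.F₁ C.h₂ L₁ B (C.advA4 x₀ A) (C.hashIn_advA4 x₀ A)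
  -- Step 1 (Lemma 5.3 (ii)): the escape count of `advB1` versus that of `advB0`
  have h1 := card_mul_card_escape_piFamily_le (Ω := G₂ × (G₃ × (Ρ × Ω))) (baseL C.f C.hp T M) (t := t) (C.advB1 x₀ A)
  have h1eq : ((univ : Finset ((Fin t → 𝒳 × 𝒦 × Fin M) × (G₂ × (G₃ × (Ρ × Ω))))).filter
        fun q => (C.advA4 x₀ A q.1 q.2.1 q.2.2).1 ∉ L₁ q.1).card =
      ((univ : Finset ((Fin t → 𝒳 × 𝒦 × Fin M) × (G₂ × (G₃ × (Ρ × Ω))))).filter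
        fun p => C.advB1 x₀ A p.1 p.2 ∉ piFamily (baseL C.f C.hp T M) t p.1).card := rfl
  -- Step 0 (Claim 4.6)
  have h0 := card_mul_card_escape_baseL_le C.f C.hp M (T := T)
    (Ω₀ := Fin t × (Fin t → 𝒳 × 𝒦 × Fin M) × (G₂ × (G₃ × (Ρ × Ω)))) h2 hT (C.baseF_advB0 x₀ A)
  have h0eq : ((univ : Finset ((𝒳 × 𝒦 × Fin M) × (Fin t × (Fin t → 𝒳 × 𝒦 × Fin M) × (G₂ × (G₃ × (Ρ × Ω)))))).filter
        fun q : (𝒳 × 𝒦 × Fin M) × (Fin t × (Fin t → 𝒳 × 𝒦 × Fin M) × (G₂ × (G₃ × (Ρ × Ω)))) =>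
          C.advB0 x₀ A q.1 q.2 ∉ baseL C.f C.hp T M q.1).card =
      ((univ : Finset ((𝒳 × 𝒦 × Fin M) × (Fin t × (Fin t → 𝒳 × 𝒦 × Fin M) × (G₂ × (G₃ × (Ρ × Ω)))))).filter
        fun q => coordAdv (C.advB1 x₀ A) q.1 q.2 ∉ baseL C.f C.hp T M q.1).card := rfl
  -- positivity of the normalisations
  have hX : (0 : ℝ) < Fintype.card 𝒳 := by exact_mod_cast Fintype.card_pos
  have hD : (0 : ℝ) < Fintype.card (𝒳 × 𝒦 × Fin M) := by
    have : 0 < Fintype.card (𝒳 × 𝒦 × Fin M) := by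
      rw [Fintype.card_prod, Fintype.card_prod, Fintype.card_fin]
      exact Nat.mul_pos Fintype.card_pos (Nat.mul_pos Fintype.card_pos hM)
    exact_mod_cast this
  -- the chain, in `ℝ`
  rw [h4, h4']
  rw [h3'] at h3
  rw [h1eq] at h2'
  rw [← h0eq] at h1
  rw [Fintype.card_prod] at h3
  rw [Fintype.card_prod, Fintype.card_prod] at h2'
  -- name the counts
  set M₅ := ((univ : Finset (((Fin t → 𝒳 × 𝒦 × Fin M) × G₂) × G₃ × (Ρ × Ω))).filter
        fun q => C.advA5 x₀ A q.1 q.2.1 q.2.2 ≠ (q.1, q.2.1)).card with hM₅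
  set M₄ := ((univ : Finset ((Fin t → 𝒳 × 𝒦 × Fin M) × G₂ × (G₃ × (Ρ × Ω)))).filter
        fun q => C.advA4 x₀ A q.1 q.2.1 q.2.2 ≠ (q.1, q.2.1)).card with hM₄
  set E₂ := ((univ : Finset ((Fin t → 𝒳 × 𝒦 × Fin M) × (G₂ × (G₃ × (Ρ × Ω))))).filter
        fun p => C.advB1 x₀ A p.1 p.2 ∉ piFamily (baseL C.f C.hp T M) t p.1).card with hE₂
  set E₀ := ((univ : Finset ((𝒳 × 𝒦 × Fin M) × (Fin t × (Fin t → 𝒳 × 𝒦 × Fin M) × (G₂ × (G₃ × (Ρ × Ω)))))).filter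
        fun q : (𝒳 × 𝒦 × Fin M) × (Fin t × (Fin t → 𝒳 × 𝒦 × Fin M) × (G₂ × (G₃ × (Ρ × Ω)))) =>
          C.advB0 x₀ A q.1 q.2 ∉ baseL C.f C.hp T M q.1).card with hE₀
  set Big := ((univ : Finset (Fin t → 𝒳 × 𝒦 × Fin M)).filter fun w => B < (L₁ w).card).card with hBig
  set Bad₂ := ((univ : Finset ((Fin t → 𝒳 × 𝒦 × Fin M) × G₂)).filter fun p =>
      ∃ w' ∈ truncFam L₁ B p.1, w' ≠ p.1 ∧ C.h₂ p.2 w' = C.h₂ p.2 p.1).card with hBad₂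
  set Bad₃ := ((univ : Finset (((Fin t → 𝒳 × 𝒦 × Fin M) × G₂) × G₃)).filter fun p =>
      ∃ y' ∈ Img, y' ≠ C.F₂ p.1 ∧ C.h₃ p.2 y' = C.h₃ p.2 (C.F₂ p.1)).card with hBad₃
  have h3R : (M₅ : ℝ) ≤ M₄ + (Fintype.card Ρ * Fintype.card Ω) * Bad₃ := by exact_mod_cast h3
  have h2R : (M₄ : ℝ) ≤ E₂ + Big * (Fintype.card G₂ * (Fintype.card G₃ * (Fintype.card Ρ * Fintype.card Ω))) +
      (Fintype.card G₃ * (Fintype.card Ρ * Fintype.card Ω)) * Bad₂ := by exact_mod_cast h2'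
  have h1R : (Fintype.card (𝒳 × 𝒦 × Fin M) : ℝ) * E₂ ≤ E₀ := by exact_mod_cast h1
  have hE₂ : (E₂ : ℝ) ≤ T * Fintype.card 𝒦 * invSum C.f C.hp M (C.advA0 x₀ A) /
      (Fintype.card 𝒳 * Fintype.card (𝒳 × 𝒦 × Fin M)) := by
    rw [le_div_iff₀ (mul_pos hX hD)]
    calc (E₂ : ℝ) * (Fintype.card 𝒳 * Fintype.card (𝒳 × 𝒦 × Fin M))
        = Fintype.card 𝒳 * (Fintype.card (𝒳 × 𝒦 × Fin M) * E₂) := by ring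
      _ ≤ Fintype.card 𝒳 * E₀ := mul_le_mul_of_nonneg_left h1R hX.le
      _ ≤ T * Fintype.card 𝒦 * invSum C.f C.hp M (C.advA0 x₀ A) := h0
  linarith

end CandData

end Final

/-! ### The residual counts -/

section Residual

variable {α β G R : Type*} [Fintype α] [DecidableEq α] [DecidableEq β] [Fintype G] [Fintype R] [DecidableEq R]

omit [DecidableEq α] in
/-- **Accessible side: few tuples have a large product set.** If `B ≥ 2^{t·E[log₂|L|] + tη·log₂|α|}` then
`#{w : |L'(w)| > B} ≤ exp(−2tη²) |α|ᵗ`. [cite: HaitnerEtAl2020, Lemma 5.3 (ii), Eq. (5.1)] -/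
theorem card_large_piFamily_le [Nonempty α] {L : α → Finset α} (hL : ∀ a, 0 < (L a).card) {t : ℕ} (ht : 0 < t)
    {η : ℝ} (hη : 0 ≤ η) (hα : 1 < Fintype.card α) {B : ℕ}
    (hB : (2 : ℝ) ^ (t * accEntropy L + t * η * Real.logb 2 (Fintype.card α)) ≤ B) :
    (((univ : Finset (Fin t → α)).filter fun w => B < (piFamily L t w).card).card : ℝ) ≤
      Real.exp (-2 * t * η ^ 2) * (Fintype.card α : ℝ) ^ t := by
  refine le_trans ?_ (card_accEntropy_piFamily_ge_le_exp hL ht hη hα)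
  refine Nat.cast_le.2 (Finset.card_le_card fun w hw => ?_)
  rw [Finset.mem_filter] at hw ⊢
  refine ⟨Finset.mem_univ _, ?_⟩
  have hBpos : (0 : ℝ) < B := lt_of_lt_of_le (by positivity) hB
  have hlt : (B : ℝ) < (piFamily L t w).card := by exact_mod_cast hw.2
  calc (t : ℝ) * accEntropy L + t * η * Real.logb 2 (Fintype.card α)
      = Real.logb 2 ((2 : ℝ) ^ (t * accEntropy L + t * η * Real.logb 2 (Fintype.card α))) :=
        (Real.logb_rpow (by norm_num) (by norm_num)).symm
    _ ≤ Real.logb 2 B := Real.logb_le_logb_of_le (by norm_num) (by positivity) hB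
    _ ≤ Real.logb 2 ((piFamily L t w).card : ℝ) := Real.logb_le_logb_of_le (by norm_num) hBpos hlt.le

/-- **Real side: few tuples have a small fibre.** If `N ≤ 2^{t·realEntropy F − tη·log₂|α|}` then
`#{w : |(Fᵗ)⁻¹(Fᵗ w)| < N} ≤ exp(−2tη²) |α|ᵗ`. [cite: HaitnerEtAl2020, Lemma 5.3 (i)] -/
theorem card_small_fiber_prodMap_le [Nonempty α] (F : α → β) {t : ℕ} (ht : 0 < t) {η : ℝ} (hη : 0 ≤ η)
    (hα : 1 < Fintype.card α) {N : ℕ} (hN : (N : ℝ) ≤ (2 : ℝ) ^ (t * realEntropy F - t * η * Real.logb 2 (Fintype.card α))) :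
    (((univ : Finset (Fin t → α)).filter fun w => (fiber univ (prodMap F t) (prodMap F t w)).card < N).card : ℝ) ≤
      Real.exp (-2 * t * η ^ 2) * (Fintype.card α : ℝ) ^ t := by
  refine le_trans ?_ (card_realEntropy_prodMap_le_le_exp F ht hη hα)
  refine Nat.cast_le.2 (Finset.card_le_card fun w hw => ?_)
  rw [Finset.mem_filter] at hw ⊢
  refine ⟨Finset.mem_univ _, ?_⟩
  have hpos : (0 : ℝ) < (fiber univ (prodMap F t) (prodMap F t w)).card := by
    exact_mod_cast card_fiber_pos (prodMap F t) (Finset.mem_univ w)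
  have hlt : ((fiber univ (prodMap F t) (prodMap F t w)).card : ℝ) < N := by exact_mod_cast hw.2
  calc Real.logb 2 ((fiber univ (prodMap F t) (prodMap F t w)).card : ℝ)
      ≤ Real.logb 2 N := Real.logb_le_logb_of_le (by norm_num) hpos hlt.le
    _ ≤ Real.logb 2 ((2 : ℝ) ^ (t * realEntropy F - t * η * Real.logb 2 (Fintype.card α))) :=
        Real.logb_le_logb_of_le (by norm_num) (lt_trans hpos hlt) hN
    _ = t * realEntropy F - t * η * Real.logb 2 (Fintype.card α) := Real.logb_rpow (by norm_num) (by norm_num)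

/-- **Designated collisions inside the truncated family are few** (Eq. (5.4) summed): for `h` pairwise
independent on the whole domain, `Bad₂ · |R| ≤ |α| · max B 1 · |G|`.
[cite: HaitnerEtAl2020, Lemma 5.4 (ii), Eq. (5.4)] -/
theorem card_bad_truncFam_mul_le (L : α → Finset α) (B : ℕ) {h : G → α → R}
    (hK : IsPairwiseIndep (univ : Finset G) h (univ : Finset α)) :
    ((univ : Finset (α × G)).filter fun p => ∃ a' ∈ truncFam L B p.1, a' ≠ p.1 ∧ h p.2 a' = h p.2 p.1).card *
        Fintype.card R ≤ Fintype.card α * max B 1 * Fintype.card G := by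
  have h1 := card_exists_collide_mul_le hK id (fun a => Finset.mem_univ a) (truncFam L B) (fun a => Finset.subset_univ _)
  refine h1.trans (Nat.mul_le_mul_right _ ?_)
  calc ∑ a, (truncFam L B a).card ≤ ∑ _a : α, max B 1 := Finset.sum_le_sum fun a _ => card_truncFam_le L B a
    _ = Fintype.card α * max B 1 := by rw [Finset.sum_const, Finset.card_univ, smul_eq_mul]

/-- **The light inputs of `hashIn F h` are few** (Lemma 5.4 (i) via Chebyshev, summed over the inputs):
with `light(a, g) :⟺ 2|R| · |sameHash(a,g)| ≤ N_thr − 1`,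
`#light · (N_thr − 1) ≤ #{a : |F⁻¹(F a)| < N_thr} · |G| · (N_thr − 1) + |α| · 4|R||G|`, for `h` pairwise and
three-wise independent on the domain. Inputs that are not light have `hashIn`-fibres of more than
`(N_thr − 1)/(2|R|)` elements. [cite: HaitnerEtAl2020, Lemma 5.4 (i)] -/
theorem card_light_hashIn_mul_le (F : α → β) {h : G → α → R}
    (hK2 : IsPairwiseIndep (univ : Finset G) h (univ : Finset α)) (hK3 : IsThreewiseIndep (univ : Finset G) h (univ : Finset α))
    (Nthr : ℕ) :
    ((univ : Finset (α × G)).filter fun p => 2 * Fintype.card R * (sameHash F h p.1 p.2).card ≤ Nthr - 1).card * (Nthr - 1) ≤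
      ((univ : Finset α).filter fun a => (fiber univ F (F a)).card < Nthr).card * Fintype.card G * (Nthr - 1) +
        Fintype.card α * (4 * Fintype.card R * Fintype.card G) := by
  classical
  set R' := Fintype.card R with hR'
  set c : α → ℕ := fun a => ((univ : Finset G).filter fun g => 2 * R' * (sameHash F h a g).card ≤ Nthr - 1).card with hc
  have hcount : ((univ : Finset (α × G)).filter fun p => 2 * R' * (sameHash F h p.1 p.2).card ≤ Nthr - 1).card = ∑ a, c a := by
    rw [Finset.card_filter, Fintype.sum_prod_type]
    refine Finset.sum_congr rfl fun a _ => ?_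
    simp only [hc, Finset.card_filter]
  rw [hcount, ← Finset.sum_filter_add_sum_filter_not (univ : Finset α) (fun a => (fiber univ F (F a)).card < Nthr),
    add_mul, Finset.sum_mul, Finset.sum_mul]
  refine Nat.add_le_add ?_ ?_
  · -- small fibres: count all keys
    calc ∑ a ∈ (univ : Finset α).filter (fun a => (fiber univ F (F a)).card < Nthr), c a * (Nthr - 1)
        ≤ ∑ _a ∈ (univ : Finset α).filter (fun a => (fiber univ F (F a)).card < Nthr), Fintype.card G * (Nthr - 1) :=
          Finset.sum_le_sum fun a _ => Nat.mul_le_mul_right _ (by rw [hc]; exact Finset.card_le_univ _)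
      _ = _ := by rw [Finset.sum_const, smul_eq_mul, mul_assoc]
  · -- large fibres: Chebyshev on the fibre
    calc ∑ a ∈ (univ : Finset α).filter (fun a => ¬ (fiber univ F (F a)).card < Nthr), c a * (Nthr - 1)
        ≤ ∑ _a ∈ (univ : Finset α).filter (fun a => ¬ (fiber univ F (F a)).card < Nthr), 4 * R' * Fintype.card G := by
          refine Finset.sum_le_sum fun a ha => ?_
          rw [Finset.mem_filter, not_lt] at ha
          have hNa : Nthr ≤ (fiber univ F (F a)).card := ha.2
          have hK2a : IsPairwiseIndep (univ : Finset G) h (fiber univ F (F a)) :=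
            fun x _ x' _ hne y y' => hK2 x (Finset.mem_univ _) x' (Finset.mem_univ _) hne y y'
          have hK3a : IsThreewiseIndep (univ : Finset G) h (fiber univ F (F a)) :=
            fun x _ x' _ x'' _ h1 h2 h3 y y' y'' =>
              hK3 x (Finset.mem_univ _) x' (Finset.mem_univ _) x'' (Finset.mem_univ _) h1 h2 h3 y y' y''
          have hcheb := card_sameHash_small_mul_le F a hK2a hK3a
          have hmono : c a ≤ ((univ : Finset G).filter fun g => 2 * R' * (sameHash F h a g).card ≤ (fiber univ F (F a)).card - 1).card := by
            rw [hc]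
            refine Finset.card_le_card (Finset.monotone_filter_right _ fun g _ hg => ?_)
            exact hg.trans (by omega)
          calc c a * (Nthr - 1)
              ≤ ((univ : Finset G).filter fun g => 2 * R' * (sameHash F h a g).card ≤ (fiber univ F (F a)).card - 1).card *
                  ((fiber univ F (F a)).card - 1) := Nat.mul_le_mul hmono (by omega)
            _ ≤ 4 * R' * Fintype.card G := hcheb
      _ ≤ Fintype.card α * (4 * R' * Fintype.card G) := by
          rw [Finset.sum_const, smul_eq_mul]
          exact Nat.mul_le_mul_right _ (Finset.card_le_univ _)

variable [DecidableEq G]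

/-- Inputs of `hashIn F h` that are not light have large fibres: if `N_thr − 1 < 2|R| · |sameHash(a,g)|` then
`(N_thr − 1)/(2|R|) + 2 ≤ |F'⁻¹(F'(a,g))|`. [cite: HaitnerEtAl2020, Lemma 5.4 (i)] -/
theorem le_card_fiber_hashIn_of_not_light (F : α → β) (h : G → α → R) {Nthr : ℕ} {a : α} {g : G}
    (hng : ¬ 2 * Fintype.card R * (sameHash F h a g).card ≤ Nthr - 1) :
    (Nthr - 1) / (2 * Fintype.card R) + 2 ≤ (fiber univ (hashIn F h) (hashIn F h (a, g))).card := by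
  rw [card_fiber_hashIn]
  have hlt := not_le.1 hng
  have hR : 0 < 2 * Fintype.card R := by
    rcases Nat.eq_zero_or_pos (2 * Fintype.card R) with h0 | h0
    · rw [h0, zero_mul] at hlt; exact absurd hlt (Nat.not_lt_zero _)
    · exact h0
  have : (Nthr - 1) / (2 * Fintype.card R) < (sameHash F h a g).card := by
    rw [Nat.div_lt_iff_lt_mul hR]; rw [mul_comm] at hlt; exact hlt
  omega

end Residual

end HHRVW

end Literature.Computability.Cryptography
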